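import Literature.Computability.AlgebraicComplexity.KronRectThirteenSix
import HarnessLib

/-!
# The column `k_13(δ)` after `k_13(6) > 0`: `k_13(δ) > 0` for every `δ ≥ 16`, and the values `e(δ² − 13)` (theorem-only)

Bürgisser–Ikenmeyer 2017 §5 [BurgisserIkenmeyer2017]: `E(m) = {mδ : k_m(δ) > 0}` is a submonoid of `ℕ`
(eq. (5.1)–(5.2), Rem. 5.18), `k_j(δ) = k_{δ²−j}(δ)` (complement symmetry, eq. (5.2); Amanov–Yeliussizov
2022 Thm. 5.1 (ii) [AmanovYeliussizov2022]) and `e(m) = min E(m) ∖ {0}` (Problem 5.19: "determine `e(m)`").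
For `m = 13` the tree knew `k_13(4) = 2` (`kronRect_thirteen_four`), `k_13(13) > 0` (`kronRect_self_pos`)
and hence `k_13(δ) > 0` on the numerical semigroup `⟨4, 13⟩` (every `δ ≥ 36` and `δ ∈ {4, 8, 12, 13, 16,
17, 20, 21, 24, 25, 26, 28, 29, 30, 32, 33, 34}`). With the kernel certificate
`kronRect_thirteen_six_pos : k_13(6) > 0` (`AC/KronRectThirteenSix.lean`) the semigroup becomes
`⟨4, 6, 13⟩ = {4, 6, 8, 10, 12, 13, 14} ∪ [16, ∞)`: this file records

* `kronRect_thirteen_pos_of_even`: `k_13(δ) > 0` for every even `δ ≥ 4`;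
* `kronRect_thirteen_pos_of_sixteen_le`: **`k_13(δ) > 0` for every `δ ≥ 16`** (new cases `δ = 18, 19, 22,
  23, 27, 31, 35`; together with `6, 10, 14`);
* the near-square values `e(δ² − 13) = (δ² − 13)·δ` for every `δ ≥ 16` and for `δ ∈ {10, 14}`
  (`genericTensorMinimalDegree_sq_sub_thirteen`, **`e(87) = 870`** — listed as open in
  `BI17MinimalDegreeTableExtension` —, `e(183) = 2562`), by the tree's near-square principle
  `genericTensorMinimalDegree_sq_sub_eq`;
* the same bookkeeping for `m = 23` from `k_23(6) > 0`: `k_23(6t) > 0`, `k_23(6t + 23) > 0`, e.g.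
  `e(301) = 5418` (`δ = 18`).

What stays open for `m = 13`: `k_13(δ)` for `δ ∈ {5, 7, 9, 11, 15}` (`k_13(5) = k_12(5)` and `k_13(7)` are
atoms of BI Ex. 5.6's shape clause; `k_13(1) = k_13(2) = k_13(3) = 0`).

Honest framing (cell `val-lit`, seat t04 g9, row BI2017-B): consequences of one kernel computation through
the tree's own semigroup lemmas; no definitions, no named facts; VP ≠ VNP is NOT proved and nothing here
bears on it.

## References

* [BurgisserIkenmeyer2017] P. Bürgisser, C. Ikenmeyer, *Fundamental invariants of orbit closures*,
  J. Algebra 477 (2017) 390–434, §5: eq. (5.1)–(5.2), Rem. 5.18, Ex. 5.6, Problem 5.19.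
* [AmanovYeliussizov2022] A. Amanov, D. Yeliussizov, *Fundamental invariants of tensors, Latin hypercubes,
  and rectangular Kronecker coefficients*, IMRN 2023 = arXiv:2202.11059, Thm. 5.1 (ii), Rem. 8.8.

## Mathlib and tree

Tree: `kronRect_thirteen_six_pos`, `kronRect_twentyThree_six_pos`, `kronRect_thirteen_four`,
`kronRect_self_pos`, `kronRect_add_pos`, `kronRect_sq_sub_pos`, `genericTensorMinimalDegree_sq_sub_eq`,
`genericTensorDegreeMonoid_eq_kronRect`.
-/

noncomputable section

namespace Literature.Computability.AlgebraicComplexity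

/-! ### §1 The column `m = 13` -/

/-- `k_13(4) > 0` (`= 2`, BI Ex. 5.6). [cite: BurgisserIkenmeyer2017, Ex. 5.6] -/
theorem kronRect_thirteen_four_pos : 0 < kronRect ℂ 13 4 := by
  rw [kronRect_thirteen_four]; norm_num

/-- **`k_13(δ) > 0` for every even `δ ≥ 4`** (`δ ∈ ⟨4, 6⟩`; the semigroup property fed with
`k_13(4) = 2` and the certificate `k_13(6) > 0`). [cite: BurgisserIkenmeyer2017, Rem. 5.18 and Problem 5.19] -/
theorem kronRect_thirteen_pos_of_even {δ : ℕ} (h4 : 4 ≤ δ) (he : Even δ) : 0 < kronRect ℂ 13 δ := by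
  induction δ using Nat.strong_induction_on with
  | _ δ ih =>
    obtain ⟨n, rfl⟩ := he
    have h2 : 2 ≤ n := by omega
    rcases Nat.lt_or_ge n 4 with hn | hn
    · interval_cases n
      · exact kronRect_thirteen_four_pos
      · exact kronRect_thirteen_six_pos ℂ
    · have h := ih (n - 2 + (n - 2)) (by omega) (by omega) ⟨n - 2, rfl⟩
      have h' := kronRect_add_pos (by norm_num) h kronRect_thirteen_four_pos
      have e : n - 2 + (n - 2) + 4 = n + n := by omega
      rwa [e] at h'

/-- **`k_13(δ) > 0` for every odd `δ ≥ 17`** (`δ = (δ − 13) + 13` with `δ − 13` even `≥ 4`, `k_13(13) > 0`).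
[cite: BurgisserIkenmeyer2017, Rem. 5.18 and Problem 5.19] -/
theorem kronRect_thirteen_pos_of_odd {δ : ℕ} (h17 : 17 ≤ δ) (ho : Odd δ) : 0 < kronRect ℂ 13 δ := by
  obtain ⟨n, rfl⟩ := ho
  have h := kronRect_thirteen_pos_of_even (δ := 2 * n + 1 - 13) (by omega) ⟨n - 6, by omega⟩
  have h' := kronRect_add_pos (by norm_num) h (kronRect_self_pos 13 (by norm_num))
  have e : 2 * n + 1 - 13 + 13 = 2 * n + 1 := by omega
  rwa [e] at h'

/-- **`k_13(δ) > 0` for every `δ ≥ 16`.** [cite: BurgisserIkenmeyer2017, Rem. 5.18 and Problem 5.19] -/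
theorem kronRect_thirteen_pos_of_sixteen_le {δ : ℕ} (h16 : 16 ≤ δ) : 0 < kronRect ℂ 13 δ := by
  rcases Nat.even_or_odd δ with he | ho
  · exact kronRect_thirteen_pos_of_even (by omega) he
  · have h17 : 17 ≤ δ := by
      obtain ⟨n, rfl⟩ := ho
      omega
    exact kronRect_thirteen_pos_of_odd h17 ho

/-- The new small cases one by one: `k_13(10), k_13(14) > 0`. [cite: BurgisserIkenmeyer2017, Problem 5.19] -/
theorem kronRect_thirteen_ten_fourteen_pos : 0 < kronRect ℂ 13 10 ∧ 0 < kronRect ℂ 13 14 :=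
  ⟨kronRect_thirteen_pos_of_even (by norm_num) (by decide),
    kronRect_thirteen_pos_of_even (by norm_num) (by decide)⟩

/-- `13δ ∈ E(13)` for every `δ ≥ 16` and every even `δ ≥ 4`: the degree monoid of generic `13 × 13 × 13`
tensors contains every multiple of `13` from `208` on. [cite: BurgisserIkenmeyer2017, §5 eq. (5.2)] -/
theorem mul_mem_genericTensorDegreeMonoid_thirteen {δ : ℕ} (h : 16 ≤ δ ∨ (4 ≤ δ ∧ Even δ)) :
    13 * δ ∈ genericTensorDegreeMonoid (Fin 13) ℂ := by
  rw [genericTensorDegreeMonoid_eq_kronRect 13]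
  rcases h with h16 | ⟨h4, he⟩
  · exact ⟨δ, rfl, kronRect_thirteen_pos_of_sixteen_le h16⟩
  · exact ⟨δ, rfl, kronRect_thirteen_pos_of_even h4 he⟩

/-! ### §2 The near-square values `e(δ² − 13)` -/

/-- **`e(δ² − 13) = (δ² − 13)·δ` for every `δ ≥ 16`** (complement symmetry `k_{δ²−13}(δ) = k_13(δ) > 0` and
the near-square principle: `δ² − 13 > (δ − 1)²` once `δ ≥ 8`).
[cite: BurgisserIkenmeyer2017, §5 eq. (5.2) and Problem 5.19] [cite: AmanovYeliussizov2022, Thm. 5.1 (ii) and Rem. 8.8] -/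
theorem genericTensorMinimalDegree_sq_sub_thirteen {δ : ℕ} (h16 : 16 ≤ δ) :
    genericTensorMinimalDegree (Fin (δ * δ - 13)) ℂ = (δ * δ - 13) * δ :=
  genericTensorMinimalDegree_sq_sub_eq (by omega) (kronRect_thirteen_pos_of_sixteen_le h16)

/-- `e(δ² − 13) = (δ² − 13)·δ` for every even `δ ≥ 8`. [cite: BurgisserIkenmeyer2017, Problem 5.19] -/
theorem genericTensorMinimalDegree_sq_sub_thirteen_of_even {δ : ℕ} (h8 : 8 ≤ δ) (he : Even δ) :
    genericTensorMinimalDegree (Fin (δ * δ - 13)) ℂ = (δ * δ - 13) * δ :=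
  genericTensorMinimalDegree_sq_sub_eq (by omega) (kronRect_thirteen_pos_of_even (by omega) he)

/-- `k_87(10) > 0` (`= k_13(10)`, `13 + 87 = 10²`; `k_13(10) = k_13(4 + 6)`).
[cite: BurgisserIkenmeyer2017, §5 eq. (5.2)] -/
theorem kronRect_eightySeven_ten_pos : 0 < kronRect ℂ 87 10 :=
  kronRect_sq_sub_pos (δ := 10) (j := 13) (by norm_num) kronRect_thirteen_ten_fourteen_pos.1

/-- **`e(87) = 870 = 87·10`** — the `δ = 10` window entry `j = 13` that `BI17MinimalDegreeTableExtension`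
lists as open (`87 > 81 = 9²` forces `δ ≥ 10`; `k_87(10) = k_13(10) > 0`).
[cite: BurgisserIkenmeyer2017, Problem 5.19] -/
theorem genericTensorMinimalDegree_eightySeven : genericTensorMinimalDegree (Fin 87) ℂ = 870 :=
  genericTensorMinimalDegree_sq_sub_thirteen_of_even (δ := 10) (by norm_num) (by decide)

/-- **`e(183) = 2562 = 183·14`** (`δ = 14`, `j = 13`: `k_183(14) = k_13(14) = k_13(4 + 4 + 6) > 0`).
[cite: BurgisserIkenmeyer2017, Problem 5.19] -/
theorem genericTensorMinimalDegree_oneEightyThree : genericTensorMinimalDegree (Fin 183) ℂ = 2562 :=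
  genericTensorMinimalDegree_sq_sub_thirteen_of_even (δ := 14) (by norm_num) (by decide)

/-- The first odd-`δ` instances that need `k_13(6)`: `e(348) = 6612 = 348·19` (`δ = 19 = 6 + 13`) and
`e(516) = 11868 = 516·23` (`δ = 23 = 4 + 6 + 13`). [cite: BurgisserIkenmeyer2017, Problem 5.19] -/
theorem genericTensorMinimalDegree_threeFortyEight_fiveSixteen :
    genericTensorMinimalDegree (Fin 348) ℂ = 6612 ∧ genericTensorMinimalDegree (Fin 516) ℂ = 11868 :=
  ⟨genericTensorMinimalDegree_sq_sub_thirteen (δ := 19) (by norm_num),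
    genericTensorMinimalDegree_sq_sub_thirteen (δ := 23) (by norm_num)⟩

/-! ### §3 The column `m = 23` from `k_23(6) > 0` -/

/-- `k_23(6t) > 0` for every `t ≥ 1` (`k_23(6) > 0` and the semigroup property).
[cite: BurgisserIkenmeyer2017, Rem. 5.18 and Problem 5.19] -/
theorem kronRect_twentyThree_six_mul_pos {t : ℕ} (ht : 1 ≤ t) : 0 < kronRect ℂ 23 (6 * t) := by
  induction t, ht using Nat.le_induction with
  | base => simpa using kronRect_twentyThree_six_pos
  | succ t ht ih =>
    have h := kronRect_add_pos (by norm_num) ih kronRect_twentyThree_six_pos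
    have e : 6 * t + 6 = 6 * (t + 1) := by ring
    rwa [e] at h

/-- `k_23(6t + 23) > 0` for every `t` (`k_23(23) > 0`). [cite: BurgisserIkenmeyer2017, Rem. 5.18] -/
theorem kronRect_twentyThree_six_mul_add_pos (t : ℕ) : 0 < kronRect ℂ 23 (6 * t + 23) := by
  rcases Nat.eq_zero_or_pos t with rfl | ht
  · simpa using kronRect_self_pos 23 (by norm_num)
  · exact kronRect_add_pos (by norm_num) (kronRect_twentyThree_six_mul_pos ht)
      (kronRect_self_pos 23 (by norm_num))

/-- **`e(301) = 5418 = 301·18`** (`δ = 18`, `j = 23`: `k_301(18) = k_23(18) = k_23(6 + 6 + 6) > 0`;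
`301 > 289 = 17²`) and **`e(818) = 23722 = 818·29`** (`δ = 29 = 6 + 23`).
[cite: BurgisserIkenmeyer2017, Problem 5.19] [cite: AmanovYeliussizov2022, Thm. 5.1 (ii) and Rem. 8.8] -/
theorem genericTensorMinimalDegree_threeOhOne_eightEighteen :
    genericTensorMinimalDegree (Fin 301) ℂ = 5418 ∧ genericTensorMinimalDegree (Fin 818) ℂ = 23722 :=
  ⟨genericTensorMinimalDegree_sq_sub_eq (δ := 18) (j := 23) (by norm_num)
      (kronRect_twentyThree_six_mul_pos (t := 3) (by norm_num)),
    genericTensorMinimalDegree_sq_sub_eq (δ := 29) (j := 23) (by norm_num)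
      (kronRect_twentyThree_six_mul_add_pos 1)⟩

end Literature.Computability.AlgebraicComplexity

end
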